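import Literature.AlgebraicGeometry.Morphisms.FormalModuleKernel
import Literature.AlgebraicGeometry.Morphisms.FormalModuleCompletion
import Literature.AlgebraicGeometry.Modules.IsZeroOfAffineCover
import Literature.AlgebraicGeometry.Modules.IsoOfSectionsOnBasis
import Mathlib.RingTheory.Filtration
import HarnessLib

/-!
# Completion commutes with kernels (coherent formal modules, quotient model)

Görtz–Wedhorn, *Algebraic Geometry II* (2023), Cor. 24.90 / Prop. 24.91 (p. 565): the completion
functor `𝓕 ↦ 𝓕_{/Z}` from coherent `𝒪_X`-modules to coherent `𝒪_{X/Z}`-modules is EXACT (affine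
locally it is `M ↦ M ⊗_A Â`, and `Â` is flat over the noetherian `A`, Prop. 24.88; The Stacks
Project, Tag 087X). In the quotient model of `Morphisms/FormalModuleTower` (towers `(𝓕/aⁿ⁺¹𝓕)_n`,
`Morphisms/FormalModuleCompletion`) cokernels are levelwise (`…CompletionCokernel`) but kernels
are the Artin–Rees shifted quotient towers `kerShift` of `Morphisms/FormalModuleKernel`. This file
proves the kernel half: for an EPIMORPHISM `w : P ↠ Q` of coherent modules with kernel `F` on a
noetherian scheme and `u = (w mod aⁿ⁺¹)_n : (P/aⁿ⁺¹P) → (Q/aⁿ⁺¹Q)`,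

* `kernelToKerTower` — the canonical maps `λ_m : F → K_m = ker u_m`;
* `cmplKernelHom` — the induced morphism of towers `θ : (F/aⁿ⁺¹F)_n → kerShift a u c`,
  `θ_n = (λ_{c+n} mod aⁿ⁺¹)`, compatible with the augmentation to `(P/aⁿ⁺¹P)_n`
  (`cmplKernelHom_comp_kerShiftAugHom`);
* `exists_forall_isIso_cmplKernelHom` — **`θ` is an isomorphism for every `c ≥ c₀`**: on an affine
  open `V`, `Γ(V, K_m) = (F(V) + aᵐ⁺¹P(V))/aᵐ⁺¹P(V)` so `θ_n` is onto, and it is injective as soon as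
  `F(V) ∩ a^{c+n+1}P(V) ⊆ aⁿ⁺¹F(V)`, which is the Artin–Rees lemma (Mathlib
  `Ideal.exists_pow_inf_eq_pow_smul`) with `c₀` uniform over a finite affine cover;
* `isFormalTower_kerShift_cmplMap` — hence `kerShift a u c` is a formal tower for `c ≥ c₀`.

Everything is proved; no named facts.

## References

* U. Görtz, T. Wedhorn, *Algebraic Geometry II: Cohomology of Schemes*, Springer Spektrum (2023),
  Prop. 24.88, Cor. 24.90, Prop. 24.91, Rem. 24.92 (pp. 562–565). [GortzWedhorn2023]
* The Stacks Project, Tag 087X (Cohomology of Schemes, Lemma 30.23.2), Tag 00IN (Artin–Rees).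
  [StacksProject]
-/

noncomputable section

-- `TopCat.Presheaf`/`TopCat.Sheaf` are not reducible (as in Mathlib's `AlgebraicGeometry/Modules`).
set_option backward.isDefEq.respectTransparency false

open CategoryTheory AlgebraicGeometry Limits TopologicalSpace Opposite
open Literature.AlgebraicGeometry.Modules

universe u

namespace Literature.AlgebraicGeometry.Morphisms

variable {X : Scheme.{u}} (a : Γ(X, ⊤)) {P Q : X.Modules} (w : P ⟶ Q)

/-! ### Iterated transition maps of the completion tower -/

/-- `M → M/aᵐ⁺¹M → M/aⁿ⁺¹M` is `M → M/aⁿ⁺¹M` (`n ≤ m`). [folklore] -/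
@[reassoc]
theorem cmplπ_cmplTower_map (M : X.Modules) {n m : ℕ} (h : n ≤ m) :
    cmplπ a M m ≫ (cmplTower a M).map (homOfLE h).op = cmplπ a M n := by
  induction m, h using Nat.le_induction with
  | base =>
    rw [show (homOfLE (le_refl n)).op = 𝟙 (⟨n⟩ : ℕᵒᵖ) from Subsingleton.elim _ _,
      CategoryTheory.Functor.map_id]
    exact Category.comp_id _
  | succ m hnm ih =>
    rw [show (homOfLE (Nat.le_succ_of_le hnm)).op = (homOfLE (Nat.le_succ m)).op ≫ (homOfLE hnm).op
      from Subsingleton.elim _ _, Functor.map_comp, ← Category.assoc]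
    change (cmplπ a M (m + 1) ≫ towerπ (cmplTower a M) m) ≫ _ = _
    rw [towerπ_cmplTower, cmplπ_cmplStep]
    exact ih

/-! ### The canonical maps `F → ker u_m` and `F/aⁿ⁺¹F → K_{c+n}/aⁿ⁺¹K_{c+n}` -/

/-- **`λ_m : ker w → ker (w mod aᵐ⁺¹)`**, induced by `ker w → P → P/aᵐ⁺¹P`. [folklore] -/
def kernelToKerTower (m : ℕ) : kernel w ⟶ (kerTower (cmplMap a w)).obj ⟨m⟩ :=
  kernel.lift ((cmplMap a w).app ⟨m⟩) (kernel.ι w ≫ cmplπ a P m) (by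
    rw [cmplMap_app, Category.assoc, cmplπ_cmplMapApp, kernel.condition_assoc, zero_comp])

/-- `λ_m` followed by `K_m → P/aᵐ⁺¹P` is `ker w → P → P/aᵐ⁺¹P`. [folklore] -/
@[reassoc (attr := simp)]
theorem kernelToKerTower_ι (m : ℕ) :
    kernelToKerTower a w m ≫ kernel.ι ((cmplMap a w).app ⟨m⟩) = kernel.ι w ≫ cmplπ a P m :=
  kernel.lift_ι _ _ _

/-- The `λ_m` are compatible with the transition maps of the kernel tower. [folklore] -/
@[reassoc]
theorem kernelToKerTower_towerπ (m : ℕ) :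
    kernelToKerTower a w (m + 1) ≫ towerπ (kerTower (cmplMap a w)) m = kernelToKerTower a w m := by
  apply equalizer.hom_ext
  change (_ ≫ _) ≫ kernel.ι ((cmplMap a w).app ⟨m⟩) = _ ≫ kernel.ι ((cmplMap a w).app ⟨m⟩)
  rw [Category.assoc, kerTower_map_ι, kernelToKerTower_ι_assoc, kernelToKerTower_ι]
  change kernel.ι w ≫ cmplπ a P (m + 1) ≫ towerπ (cmplTower a P) m = _
  rw [towerπ_cmplTower, cmplπ_cmplStep]

/-- The same, with the index written `c + (n + 1)`. [folklore] -/
@[reassoc]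
theorem kernelToKerTower_towerπ' (c n : ℕ) :
    kernelToKerTower a w (c + (n + 1)) ≫ towerπ (kerTower (cmplMap a w)) (c + n) =
      kernelToKerTower a w (c + n) :=
  kernelToKerTower_towerπ a w (c + n)

/-- More generally for the iterated transitions. [folklore] -/
@[reassoc]
theorem kernelToKerTower_map {n m : ℕ} (h : n ≤ m) :
    kernelToKerTower a w m ≫ (kerTower (cmplMap a w)).map (homOfLE h).op = kernelToKerTower a w n := by
  apply equalizer.hom_ext
  change (_ ≫ _) ≫ kernel.ι ((cmplMap a w).app ⟨n⟩) = _ ≫ kernel.ι ((cmplMap a w).app ⟨n⟩)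
  rw [Category.assoc, kerTower_map_ι, kernelToKerTower_ι_assoc, kernelToKerTower_ι,
    cmplπ_cmplTower_map]

variable (c : ℕ)

/-- **`θ_n : F/aⁿ⁺¹F → K_{c+n}/aⁿ⁺¹K_{c+n}`**, `F = ker w`, the reduction of `λ_{c+n}`. [folklore] -/
def cmplKernelToKerShift (n : ℕ) : cmplObj a (kernel w) n ⟶ kerShiftObj a (cmplMap a w) c n :=
  cmplMapApp a (kernelToKerTower a w (c + n)) n

/-- `F → F/aⁿ⁺¹F → K_{c+n}/aⁿ⁺¹K_{c+n}` is `F → K_{c+n} → K_{c+n}/aⁿ⁺¹K_{c+n}`. [folklore] -/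
@[reassoc]
theorem cmplπ_cmplKernelToKerShift (n : ℕ) :
    cmplπ a (kernel w) n ≫ cmplKernelToKerShift a w c n =
      kernelToKerTower a w (c + n) ≫ kerShiftπ a (cmplMap a w) c n :=
  cmplπ_cmplMapApp a _ n

/-- The `θ_n` commute with the transition maps. [folklore] -/
@[reassoc]
theorem cmplStep_cmplKernelToKerShift (n : ℕ) :
    cmplStep a (kernel w) n ≫ cmplKernelToKerShift a w c n =
      cmplKernelToKerShift a w c (n + 1) ≫ kerShiftStep a (cmplMap a w) c n := by
  rw [← cancel_epi (cmplπ a (kernel w) (n + 1)), cmplπ_cmplStep_assoc, cmplπ_cmplKernelToKerShift,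
    cmplπ_cmplKernelToKerShift_assoc, kerShiftπ_kerShiftStep, kernelToKerTower_towerπ'_assoc]

/-- **The morphism of towers `θ : (F/aⁿ⁺¹F)_n → kerShift a u c`.** [cite: GortzWedhorn2023, Rem. 24.92 (p. 565)] -/
def cmplKernelHom : cmplTower a (kernel w) ⟶ kerShift a (cmplMap a w) c :=
  NatTrans.ofOpSequence (fun n => cmplKernelToKerShift a w c n) fun n => by
    change towerπ (cmplTower a (kernel w)) n ≫ cmplKernelToKerShift a w c n =
      cmplKernelToKerShift a w c (n + 1) ≫ towerπ (kerShift a (cmplMap a w) c) n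
    rw [towerπ_cmplTower, towerπ_kerShift]
    exact cmplStep_cmplKernelToKerShift a w c n

/-- Components of `θ`. [folklore] -/
@[simp]
theorem cmplKernelHom_app (n : ℕ) : (cmplKernelHom a w c).app ⟨n⟩ = cmplKernelToKerShift a w c n := rfl

/-- **`θ` followed by the augmentation `kerShift → (P/aⁿ⁺¹P)_n` is the completion of `ker w → P`.**
[cite: GortzWedhorn2023, Rem. 24.92 (p. 565)] -/
theorem cmplKernelHom_comp_kerShiftAugHom :
    cmplKernelHom a w c ≫ kerShiftAugHom (cmplMap a w) c (isFormalTower_cmplTower a P) =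
      cmplMap a (kernel.ι w) := by
  refine NatTrans.ext (funext fun k => ?_)
  obtain ⟨n⟩ := k
  rw [NatTrans.comp_app, cmplKernelHom_app, kerShiftAugHom_app, cmplMap_app,
    ← cancel_epi (cmplπ a (kernel w) n), cmplπ_cmplKernelToKerShift_assoc, kerShiftπ_kerShiftAug,
    kernelToKerTower_ι_assoc, cmplπ_cmplMapApp]
  congr 1
  exact cmplπ_cmplTower_map a P (Nat.le_add_left n c)

/-! ### Sections over an affine open -/

section Affine

variable {a w c} [IsLocallyNoetherian X] (hP : Coh P) (hQ : Coh Q) [Epi w] {V : X.Opens}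
  (hV : IsAffineOpen V)

omit [Epi w] in
include hP hQ in
/-- `ker w` is coherent. [folklore] -/
theorem coh_kernel_of_coh : Coh (kernel w) := Coh.kernel _ hP hQ

include hP hQ hV in
/-- **Every section of `K_m = ker (w mod aᵐ⁺¹)` over an affine open comes from `ker w`**: if
`y ∈ Γ(V, K_m)` has image `k = [p] ∈ P(V)/aᵐ⁺¹P(V)`, then `w(p) ∈ aᵐ⁺¹Q(V) = w(aᵐ⁺¹P(V))`, so
`p - aᵐ⁺¹p' ∈ F(V)` maps to `y`. [cite: GortzWedhorn2023, Prop. 24.91, proof (p. 565)] -/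
theorem kernelToKerTower_app_surjective (m : ℕ) :
    Function.Surjective ((kernelToKerTower a w m).app V) := by
  intro y
  have hPπ := app_surjective_and_ker_of_exact_of_epi (a ^ (m + 1)) (cmplπ a P m)
    (cokernel.condition _) (ShortComplex.exact_cokernel _) hP (coh_cmplTower a hP m) hV
  have hQπ := app_surjective_and_ker_of_exact_of_epi (a ^ (m + 1)) (cmplπ a Q m)
    (cokernel.condition _) (ShortComplex.exact_cokernel _) hQ (coh_cmplTower a hQ m) hV
  obtain ⟨p, hp⟩ := hPπ.1 ((kernel.ι ((cmplMap a w).app ⟨m⟩)).app V y)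
  -- `w p ↦ 0` in `Q/aᵐ⁺¹Q`, so `w p = aᵐ⁺¹ q = w (aᵐ⁺¹ p')`
  have hwp : (cmplπ a Q m).app V (w.app V p) = 0 := by
    have h0 := congrArg (fun φ => φ.app V y) (kernel.condition ((cmplMap a w).app ⟨m⟩))
    rw [← comp_app_apply, ← cmplπ_cmplMapApp, comp_app_apply, hp]
    exact h0
  obtain ⟨q, hq⟩ := (hQπ.2 _).mp hwp
  obtain ⟨p', rfl⟩ := app_surjective_of_epi w hP.loc hQ.loc hV q
  have hker : w.app V (p - X.presheaf.map (homOfLE (le_top : V ≤ ⊤)).op (a ^ (m + 1)) • p') = 0 := by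
    rw [map_sub, Scheme.Modules.Hom.app_smul, hq, sub_self]
  obtain ⟨f, hf⟩ := exists_kernel_ι_app_eq w V _ hker
  refine ⟨f, kernel_ι_app_injective ((cmplMap a w).app ⟨m⟩) V ?_⟩
  have hz : (cmplπ a P m).app V (X.presheaf.map (homOfLE (le_top : V ≤ ⊤)).op (a ^ (m + 1)) • p') = 0 :=
    (hPπ.2 _).mpr ⟨p', rfl⟩
  rw [← comp_app_apply, kernelToKerTower_ι, comp_app_apply, hf, map_sub]
  exact (congrArg₂ (· - ·) hp hz).trans (sub_zero _)

include hP hQ hV in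
/-- **`θ_n` is surjective on sections over affine opens** (for every `c`).
[cite: GortzWedhorn2023, Prop. 24.91, proof (p. 565)] -/
theorem cmplKernelToKerShift_app_surjective (n : ℕ) :
    Function.Surjective ((cmplKernelToKerShift a w c n).app V) := by
  intro z
  have hK : Coh ((kerTower (cmplMap a w)).obj ⟨c + n⟩) :=
    coh_kerTower (u := cmplMap a w) (coh_cmplTower a hP) (coh_cmplTower a hQ) (c + n)
  obtain ⟨y, rfl⟩ := app_surjective_of_epi (kerShiftπ a (cmplMap a w) c n) hK.loc
    (coh_kerShift (u := cmplMap a w) (c := c) (coh_cmplTower a hP) (coh_cmplTower a hQ) n).loc hV z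
  obtain ⟨f, rfl⟩ := kernelToKerTower_app_surjective hP hQ hV (c + n) y
  exact ⟨(cmplπ a (kernel w) n).app V f, by rw [← comp_app_apply, cmplπ_cmplKernelToKerShift]; rfl⟩

include hP hQ hV in
/-- **`θ_n` is injective on sections over an affine open `V` with Artin–Rees constant `≤ c`**:
if `F(V) ∩ aᵐP(V) ⊆ a^{m-c}F(V)` for `m ≥ c`, an `f ∈ F(V)` with `θ_n [f] = 0` satisfies
`λ(f - aⁿ⁺¹f₁) = 0` for some `f₁`, i.e. `f - aⁿ⁺¹f₁ ∈ F(V) ∩ a^{c+n+1}P(V) ⊆ aⁿ⁺¹F(V)`.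
[cite: GortzWedhorn2023, Prop. 24.91, proof (p. 565)] -/
theorem cmplKernelToKerShift_app_injective (n : ℕ)
    (hAR : ∀ m, c ≤ m → (Ideal.span {X.presheaf.map (homOfLE (le_top : V ≤ ⊤)).op a} ^ m • ⊤ ⊓
        LinearMap.range (appLinear (kernel.ι w) V) : Submodule Γ(X, V) Γ(P, V)) ≤
      Ideal.span {X.presheaf.map (homOfLE (le_top : V ≤ ⊤)).op a} ^ (m - c) •
        LinearMap.range (appLinear (kernel.ι w) V)) :
    Function.Injective ((cmplKernelToKerShift a w c n).app V) := by
  set aV : Γ(X, V) := X.presheaf.map (homOfLE (le_top : V ≤ ⊤)).op a with haV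
  have hF : Coh (kernel w) := coh_kernel_of_coh hP hQ
  have hK : ∀ m, Coh ((kerTower (cmplMap a w)).obj ⟨m⟩) :=
    coh_kerTower (u := cmplMap a w) (coh_cmplTower a hP) (coh_cmplTower a hQ)
  have hFπ := app_surjective_and_ker_of_exact_of_epi (a ^ (n + 1)) (cmplπ a (kernel w) n)
    (cokernel.condition _) (ShortComplex.exact_cokernel _) hF (coh_cmplTower a hF n) hV
  have hKπ := app_surjective_and_ker_of_exact_of_epi (a ^ (n + 1)) (kerShiftπ a (cmplMap a w) c n)
    (cokernel.condition _) (ShortComplex.exact_cokernel _) (hK (c + n))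
    (coh_kerShift (u := cmplMap a w) (c := c) (coh_cmplTower a hP) (coh_cmplTower a hQ) n) hV
  have hPπ := app_surjective_and_ker_of_exact_of_epi (a ^ (c + n + 1)) (cmplπ a P (c + n))
    (cokernel.condition _) (ShortComplex.exact_cokernel _) hP (coh_cmplTower a hP (c + n)) hV
  -- it suffices to treat elements `[f]`, `f ∈ F(V)`
  refine (injective_iff_map_eq_zero _).mpr fun x hx => ?_
  obtain ⟨f, rfl⟩ := hFπ.1 x
  -- `λ f ∈ aⁿ⁺¹ K(V)`, and every element of `K(V)` is a `λ f₁`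
  have h1 : (kerShiftπ a (cmplMap a w) c n).app V ((kernelToKerTower a w (c + n)).app V f) = 0 := by
    rw [← comp_app_apply, ← cmplπ_cmplKernelToKerShift, comp_app_apply, hx]
  obtain ⟨y₁, hy₁⟩ := (hKπ.2 _).mp h1
  obtain ⟨f₁, rfl⟩ := kernelToKerTower_app_surjective hP hQ hV (c + n) y₁
  -- so `g := f - aⁿ⁺¹ f₁` dies in `K_{c+n}`, i.e. `ι g ∈ a^{c+n+1} P(V)`
  set g : Γ(kernel w, V) := f - aV ^ (n + 1) • f₁ with hg
  have h2 : (kernelToKerTower a w (c + n)).app V g = 0 := by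
    rw [hg, map_sub, Scheme.Modules.Hom.app_smul, ← map_pow, hy₁, sub_self]
  have h3 : (cmplπ a P (c + n)).app V ((kernel.ι w).app V g) = 0 := by
    rw [← comp_app_apply, ← kernelToKerTower_ι, comp_app_apply, h2, map_zero]
  obtain ⟨p₂, hp₂⟩ := (hPπ.2 _).mp h3
  -- Artin–Rees: `ι g ∈ F(V) ∩ a^{c+n+1}P(V) ⊆ aⁿ⁺¹ F(V)`
  have hmem : (kernel.ι w).app V g ∈ (Ideal.span {aV} ^ (c + n + 1) • ⊤ ⊓
      LinearMap.range (appLinear (kernel.ι w) V) : Submodule Γ(X, V) Γ(P, V)) := by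
    refine ⟨?_, ⟨g, rfl⟩⟩
    rw [← hp₂, map_pow]
    exact Submodule.smul_mem_smul (Ideal.pow_mem_pow (Ideal.mem_span_singleton_self _) _) trivial
  have hmem' := hAR (c + n + 1) (by omega) hmem
  rw [show c + n + 1 - c = n + 1 by omega, ← Submodule.map_top, ← Submodule.map_smul'',
    Submodule.mem_map] at hmem'
  obtain ⟨g', hg', hgg'⟩ := hmem'
  have hgeq : g = g' := (kernel_ι_app_injective w V hgg'.symm)
  rw [Ideal.span_singleton_pow, Submodule.ideal_span_singleton_smul,
    Submodule.mem_smul_pointwise_iff_exists] at hg'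
  obtain ⟨f₂, -, hf₂⟩ := hg'
  -- hence `f = aⁿ⁺¹ (f₁ + f₂)` and `[f] = 0`
  have hf : f = aV ^ (n + 1) • (f₁ + f₂) := by
    rw [smul_add, hf₂, ← hgeq, hg, add_sub_cancel]
  rw [hf, (hFπ.2 _).mpr ⟨f₁ + f₂, by rw [map_pow]⟩]

omit [Epi w] in
include hP hV in
/-- **The Artin–Rees constant at an affine open**: `F(V) ∩ aᵐP(V) ⊆ a^{m-c}F(V)` for `m ≥ c`
(Mathlib `Ideal.exists_pow_inf_eq_pow_smul` for `F(V) ⊆ P(V)` over the noetherian `Γ(V, 𝒪_X)`).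
[cite: StacksProject, Tag 00IN] -/
theorem exists_artinRees_range_kernel_ι :
    ∃ c : ℕ, ∀ m, c ≤ m → (Ideal.span {X.presheaf.map (homOfLE (le_top : V ≤ ⊤)).op a} ^ m • ⊤ ⊓
        LinearMap.range (appLinear (kernel.ι w) V) : Submodule Γ(X, V) Γ(P, V)) ≤
      Ideal.span {X.presheaf.map (homOfLE (le_top : V ≤ ⊤)).op a} ^ (m - c) •
        LinearMap.range (appLinear (kernel.ι w) V) := by
  haveI : IsNoetherianRing Γ(X, V) := IsLocallyNoetherian.component_noetherian ⟨V, hV⟩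
  haveI : Module.Finite Γ(X, V) Γ(P, V) := hP.ft hV
  obtain ⟨k, hk⟩ := Ideal.exists_pow_inf_eq_pow_smul (Ideal.span {X.presheaf.map
    (homOfLE (le_top : V ≤ ⊤)).op a}) (LinearMap.range (appLinear (kernel.ι w) V))
  refine ⟨k, fun m hm => ?_⟩
  rw [hk m hm]
  exact smul_mono_right _ inf_le_right

end Affine

/-! ### `θ` is an isomorphism for `c ≫ 0` -/

variable {a w} [IsLocallyNoetherian X] [CompactSpace X] (hP : Coh P) (hQ : Coh Q) [Epi w]

include hP hQ in
/-- **Completion commutes with kernels** (GW II Cor. 24.90 / Prop. 24.91; Stacks 087X): for an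
epimorphism `w : P ↠ Q` of coherent modules on a noetherian scheme there is `c₀` such that for every
`c ≥ c₀` the canonical morphism of towers `θ : (ker w/aⁿ⁺¹ ker w)_n → kerShift a (w mod a^{·+1}) c`
is an isomorphism. [cite: GortzWedhorn2023, Prop. 24.91 and Rem. 24.92 (p. 565)] -/
theorem exists_forall_isIso_cmplKernelHom :
    ∃ c₀ : ℕ, ∀ c, c₀ ≤ c → IsIso (cmplKernelHom a w c) := by
  classical
  obtain ⟨T, hT⟩ := exists_finite_affineOpens_iSup_eq_top (X := X)
  choose cV hcV using fun V : T =>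
    exists_artinRees_range_kernel_ι (a := a) (w := w) hP (V : X.affineOpens).2
  refine ⟨Finset.univ.sup cV, fun c hc => ?_⟩
  have hF : Coh (kernel w) := coh_kernel_of_coh hP hQ
  have hK : ∀ n, Coh ((kerShift a (cmplMap a w) c).obj ⟨n⟩) := fun n =>
    coh_kerShift (u := cmplMap a w) (c := c) (coh_cmplTower a hP) (coh_cmplTower a hQ) n
  have hiso : ∀ n : ℕ, IsIso ((cmplKernelHom a w c).app ⟨n⟩) := fun n => by
    rw [cmplKernelHom_app]
    haveI : Mono (cmplKernelToKerShift a w c n) :=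
      mono_of_app_injective_of_cover _ (coh_cmplTower a hF n).loc (hK n).loc
        (fun V : T => ((V : X.affineOpens) : X.Opens)) (fun V => (V : X.affineOpens).2) hT
        fun V => cmplKernelToKerShift_app_injective hP hQ (V : X.affineOpens).2 n fun m hm =>
          (hcV V m ((Finset.le_sup (f := cV) (Finset.mem_univ V)).trans (hc.trans hm))).trans
            (Submodule.smul_mono_left (Ideal.pow_le_pow_right (by
              have := Finset.le_sup (f := cV) (Finset.mem_univ V); omega)))
    haveI : Epi (cmplKernelToKerShift a w c n) :=
      epi_of_surjective_app_of_isAffineOpen _ fun V hV =>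
        cmplKernelToKerShift_app_surjective hP hQ hV n
    exact isIso_of_mono_of_epi _
  haveI : ∀ k : ℕᵒᵖ, IsIso ((cmplKernelHom a w c).app k) := fun k => hiso k.unop
  exact NatIso.isIso_of_isIso_app _

omit [IsLocallyNoetherian X] [CompactSpace X] [Epi w] in
/-- A tower isomorphic to a formal tower is a formal tower. [folklore] -/
theorem IsFormalTower.of_natIso {F G : ℕᵒᵖ ⥤ X.Modules} (e : F ≅ G) (hF : IsFormalTower a F)
    (hG : ∀ n, globalScalar (G.obj ⟨n⟩) (a ^ (n + 1)) = 0) : IsFormalTower a G where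
  killed := hG
  epi n := by
    have h : towerπ G n = e.inv.app ⟨n + 1⟩ ≫ towerπ F n ≫ e.hom.app ⟨n⟩ := by
      rw [towerπ, towerπ, e.hom.naturality, ← Category.assoc, ← NatTrans.comp_app, e.inv_hom_id,
        NatTrans.id_app, Category.id_comp]
    rw [h]
    haveI := hF.epi n
    infer_instance
  exact n := by
    have hiso : ShortComplex.mk (globalScalar (G.obj ⟨n + 1⟩) (a ^ (n + 1))) (towerπ G n)
        (globalScalar_comp_towerπ G n _ (hG n)) ≅
        ShortComplex.mk (globalScalar (F.obj ⟨n + 1⟩) (a ^ (n + 1))) (towerπ F n)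
          (globalScalar_comp_towerπ F n _ (hF.killed n)) :=
      ShortComplex.isoMk (e.symm.app ⟨n + 1⟩) (e.symm.app ⟨n + 1⟩) (e.symm.app ⟨n⟩)
        (globalScalar_comp _ _).symm (by
          change e.inv.app ⟨n + 1⟩ ≫ towerπ F n = towerπ G n ≫ e.inv.app ⟨n⟩
          exact (e.inv.naturality _).symm)
    exact (ShortComplex.exact_iff_of_iso hiso).mpr (hF.exact n)

include hP hQ in
/-- **Hence `kerShift a (w mod a^{·+1}) c` is a formal tower of coherent modules for `c ≥ c₀`**
(isomorphic to the completion tower of `ker w`). [cite: GortzWedhorn2023, Cor. 24.90 (p. 565)] -/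
theorem exists_forall_iso_kerShift_cmplMap :
    ∃ c₀ : ℕ, ∀ c, c₀ ≤ c → IsFormalTower a (kerShift a (cmplMap a w) c) ∧
      ∃ θ : cmplTower a (kernel w) ≅ kerShift a (cmplMap a w) c,
        θ.hom ≫ kerShiftAugHom (cmplMap a w) c (isFormalTower_cmplTower a P) = cmplMap a (kernel.ι w) := by
  obtain ⟨c₀, hc₀⟩ := exists_forall_isIso_cmplKernelHom (a := a) (w := w) hP hQ
  refine ⟨c₀, fun c hc => ?_⟩
  haveI := hc₀ c hc
  refine ⟨IsFormalTower.of_natIso (asIso (cmplKernelHom a w c)) (isFormalTower_cmplTower a _)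
    (globalScalar_kerShift_eq_zero a _ c), asIso (cmplKernelHom a w c), ?_⟩
  exact cmplKernelHom_comp_kerShiftAugHom a w c

end Literature.AlgebraicGeometry.Morphisms

end
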